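/-
Copyright (c) 2026. All rights reserved.
Released under Apache 2.0 license as described in the file LICENSE.
Authors: abc-iut cell, seat abc-iut-w6-d025 (gen 2; block C / W6, row «Cor36-SHIFT-TELE»).
-/
import Literature.AnabelianGeometry.AbsoluteAnabelian.AbsTopIII.FrobeniusPictureMLFTelecoreConstruction
import Literature.AnabelianGeometry.AbsoluteAnabelian.AbsTopIII.FrobeniusPictureMLFShift

/-!
# [AbsTopIII] Corollary 3.6 (v), fourth sentence: the shifts `Φ_m` EXTEND to self-equivalences
# `Ψ_m` of the telecore diagram `𝒟_An` (Def. 3.5 (vi) extension technique)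

S. Mochizuki, *Topics in Absolute Anabelian Geometry III*, Cor. 3.6 (v) p. 80 of the kurims
manuscript (`paper:url-5493eb38cbb7`; bib key `MochizukiAbsTopIII2015`), fourth sentence, read on
the page: "these self-equivalences also extend naturally [cf. the technique of extension applied in
Definition 3.5, (vi)] to the diagram of categories [cf. Definition 3.5, (iv), (a)] that constitutes
the telecore of (ii), in a fashion that is compatible with both the family of homotopies that
constitutes this telecore structure [cf. Definition 3.5, (iv), (b)] and the contact structure `ℋ_An`
of (ii)" (proof, p. 82: "The remainder of assertion (v) follows immediately from the definitions").
Typed by seat abc-iut-L4-t5 as `LogFrobeniusData.ShiftTelecoreCompatStmt τ`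
(`FrobeniusPictureMLFCompatibility.lean`); seat abc-iut-L4-t10's Cor. 4.5 (v), fourth sentence, is
literally the same statement (`AbsTopIII.Cor_4_5_v_compat`, second conjunct).

This file CONSTRUCTS the extensions for the telecore `𝔗_An = anTelecore τ hν` of
`FrobeniusPictureMLFTelecoreConstruction.lean` (telecore edges `anJ`: one edge `φ_⋏` to each
`⋏ ∈ L† = L ∪ {□}`), after the shifts `Φ_m = shiftEquiv m` of `𝒟` (`FrobeniusPictureMLFShift.lean`)
and seat abc-iut-L4-t3's Cor. 5.5 (v) twin (`LogFrobeniusTelecoreShift.lean`): the morphism of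
oriented graphs `teleShift m` of `Γ⃗_{𝒟_An}` (`⋎ ↦ ⋎ + m` on the first row, its edges `log`, `id_⋎`
AND the telecore edges `φ_⋎ ↦ φ_{⋎+m}`; the identity on `□`, `𝒩`, `ℰ`, `Anab`, `φ_□`, `κ_An`), its
group law, the 1-morphism `teleShiftMor m` over it (identity functors, identity 2-cells by the
STRICT commutation `teleShift_comm`), its being an equivalence with quasi-inverse the shift by `-m`,
the self-equivalence `teleShiftEquiv m`, and the two agreement clauses of the typed statement
(`teleShiftEquiv_base`: `Ψ_m` is `Φ_m` on `𝒟_{≤4}`; `teleShiftEquiv_obs`: the identity at `Anab`).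
The Def. 3.5 (v) compatibility of `Ψ_m` with `𝒥` and `ℋ_An` follows in the continuation files.
Pure category theory over the abstract data `Δ : LogFrobeniusData`, `τ : Δ.TelecoreData`; nothing
here takes a side on inter-universal Teichmüller theory or bears on [IUTchIII] Cor. 3.12.
-/

namespace Literature.AnabelianGeometry.AbsoluteAnabelian

open _root_.CategoryTheory _root_.Quiver

universe u v' w'

/-- Two morphisms of quivers with equal vertex maps and heterogeneously equal arrow maps are equal
(bookkeeping). [folklore] -/
private theorem Prefunctor.ext_of_heq'' {V : Type w'} [Quiver.{v'} V] {F G : V ⥤q V}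
    (h_obj : ∀ X, F.obj X = G.obj X) (h_map : ∀ (X Y : V) (f : X ⟶ Y), HEq (F.map f) (G.map f)) :
    F = G := by
  obtain ⟨Fo, Fm⟩ := F
  obtain ⟨Go, Gm⟩ := G
  obtain rfl : Fo = Go := funext h_obj
  have hm : @Fm = @Gm := by
    funext X Y f
    exact eq_of_heq (h_map X Y f)
  cases hm
  rfl

namespace LFVertex

/-- The shift preserves the row of a vertex. [cite: MochizukiAbsTopIII2015, Corollary 3.6 (v) p.80] -/
theorem row_shiftObj (m : ℤ) (a : LFVertex) : (shiftObj m a).row = a.row := by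
  cases a <;> rfl

/-- The shift preserves `𝒟_{≤n}`. [cite: MochizukiAbsTopIII2015, Corollary 3.6 (v) p.80] -/
theorem shiftObj_mem_of_mem (m : ℤ) {n : ℕ} {a : LFVertex} (h : a ∈ {a : LFVertex | a.row ≤ n}) :
    shiftObj m a ∈ {a : LFVertex | a.row ≤ n} := by
  show (shiftObj m a).row ≤ n
  rw [row_shiftObj]
  exact h

/-- Group law of the shift on vertices. [cite: MochizukiAbsTopIII2015, Corollary 3.6 (v) p.80] -/
theorem shiftObj_shiftObj (m m' : ℤ) (a : LFVertex) :
    shiftObj m' (shiftObj m a) = shiftObj (m + m') a := by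
  cases a <;> simp [shiftObj, Int.add_assoc]

/-- The shift by `0` fixes every vertex. [cite: MochizukiAbsTopIII2015, Corollary 3.6 (v) p.80] -/
theorem shiftObj_zero (a : LFVertex) : shiftObj 0 a = a := by
  cases a <;> simp [shiftObj]

/-- Edges between first-row vertices with equal indices are heterogeneously equal. [folklore] -/
private theorem hom_row1_heq {i j i' j' : ℤ} (hi : i = i') (hj : j = j') (e : (row1 i : LFVertex) ⟶ row1 j)
    (e' : (row1 i' : LFVertex) ⟶ row1 j') : HEq e e' := by
  subst hi hj
  obtain ⟨⟨h⟩⟩ := e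
  obtain ⟨⟨h'⟩⟩ := e'
  exact HEq.rfl

/-- Group law of the shift on edges (heterogeneously). [cite: MochizukiAbsTopIII2015, Corollary 3.6 (v) p.80] -/
theorem shiftHom_shiftHom_heq (m m' : ℤ) {a b : LFVertex} (e : a ⟶ b) :
    HEq (shiftHom m' (shiftHom m e)) (shiftHom (m + m') e) := by
  cases a <;> cases b <;>
    first
      | exact (PEmpty.elim e)
      | exact hom_row1_heq (Int.add_assoc _ _ _) (Int.add_assoc _ _ _) _ _
      | exact HEq.rfl

/-- The shift by `0` fixes every edge (heterogeneously). [cite: MochizukiAbsTopIII2015, Corollary 3.6 (v) p.80] -/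
theorem shiftHom_zero_heq {a b : LFVertex} (e : a ⟶ b) : HEq (shiftHom 0 e) e := by
  cases a <;> cases b <;>
    first
      | exact (PEmpty.elim e)
      | exact hom_row1_heq (Int.add_zero _) (Int.add_zero _) _ _
      | exact HEq.rfl

end LFVertex

namespace LogFrobeniusData

open DiagramOfCategories

/-! ### The shift on the oriented graph `Γ⃗_{𝒟_An}` -/

/-- The shift on the telecore edges: `φ_⋎ ↦ φ_{⋎+m}`, `φ_□ ↦ φ_□`. [cite: MochizukiAbsTopIII2015, Corollary 3.6 (v) p.80] -/
def anJShift (m : ℤ) : ∀ (a : SubVertex {a : LFVertex | a.row ≤ 4})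
    (h : LFVertex.shiftObj m a.1 ∈ {a : LFVertex | a.row ≤ 4}),
    anJ.{u} a → anJ.{u} ⟨LFVertex.shiftObj m a.1, h⟩
  | ⟨.row1 _, _⟩, _, _ => PUnit.unit
  | ⟨.nexus, _⟩, _, _ => PUnit.unit
  | ⟨.third, _⟩, _, j => PEmpty.elim j
  | ⟨.fourth, _⟩, _, j => PEmpty.elim j
  | ⟨.fifth, _⟩, _, j => PEmpty.elim j
  | ⟨.sixth, _⟩, _, j => PEmpty.elim j

/-- The shift on the observation edge: `κ_An : ℰ → Anab` is fixed. [cite: MochizukiAbsTopIII2015, Corollary 3.6 (v) p.80] -/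
def coreI5Shift (m : ℤ) : ∀ (a : SubVertex {a : LFVertex | a.row ≤ 4})
    (h : LFVertex.shiftObj m a.1 ∈ {a : LFVertex | a.row ≤ 4}),
    coreI5.{u} a → coreI5.{u} ⟨LFVertex.shiftObj m a.1, h⟩
  | ⟨.fourth, _⟩, _, _ => PUnit.unit
  | ⟨.row1 _, _⟩, _, i => PEmpty.elim i
  | ⟨.nexus, _⟩, _, i => PEmpty.elim i
  | ⟨.third, _⟩, _, i => PEmpty.elim i
  | ⟨.fifth, _⟩, _, i => PEmpty.elim i
  | ⟨.sixth, _⟩, _, i => PEmpty.elim i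

/-- The shift on the vertices of `Γ⃗_{𝒟_An}`: `LFVertex.shiftObj` on `𝒟_{≤4}`, the core vertex `Anab`
fixed. [cite: MochizukiAbsTopIII2015, Corollary 3.6 (v) p.80] -/
def teleShiftObj (m : ℤ) : (teleShape anJ.{u}).Vertex → (teleShape anJ.{u}).Vertex
  | ExtVertex.base a =>
    (teleShape anJ.{u}).base ⟨LFVertex.shiftObj m a.1, LFVertex.shiftObj_mem_of_mem m a.2⟩
  | ExtVertex.obs => (teleShape anJ.{u}).obs

/-- The shift on the edges of `Γ⃗_{𝒟_An}`: `LFVertex.shiftHom` on `𝒟_{≤4}`, `κ_An` fixed, `φ_⋎ ↦ φ_{⋎+m}`,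
`φ_□` fixed. [cite: MochizukiAbsTopIII2015, Corollary 3.6 (v) p.80] -/
def teleShiftHom (m : ℤ) : ∀ {a b : (teleShape anJ.{u}).Vertex}, (a ⟶ b) →
    (teleShiftObj m a ⟶ teleShiftObj m b)
  | ExtVertex.base _, ExtVertex.base _, e => LFVertex.shiftHom m e
  | ExtVertex.base a, ExtVertex.obs, i => coreI5Shift m a _ i
  | ExtVertex.obs, ExtVertex.base b, j => anJShift m b _ j
  | ExtVertex.obs, ExtVertex.obs, e => PEmpty.elim e

/-- **The shift by `m` as a morphism of oriented graphs `Γ⃗_{𝒟_An} → Γ⃗_{𝒟_An}`** (the `ℤ`-action on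
`Γ⃗_{𝒟_{≤1}}` extended by `φ_⋎ ↦ φ_{⋎+m}` and the identity). [cite: MochizukiAbsTopIII2015, Corollary 3.6 (v) p.80] -/
def teleShift (m : ℤ) : (teleShape anJ.{u}).Vertex ⥤q (teleShape anJ.{u}).Vertex where
  obj := teleShiftObj m
  map e := teleShiftHom m e

/-- **Group law of the shifts of `Γ⃗_{𝒟_An}`**: `teleShift m ⋙ teleShift m' = teleShift (m + m')`.
[cite: MochizukiAbsTopIII2015, Corollary 3.6 (v) p.80] -/
theorem teleShift_comp (m m' : ℤ) :
    teleShift.{u} m ⋙q teleShift.{u} m' = teleShift.{u} (m + m') := by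
  refine Prefunctor.ext_of_heq'' (fun w => ?_) (fun a b e => ?_)
  · cases w with
    | base a =>
      show (teleShape anJ.{u}).base _ = (teleShape anJ.{u}).base _
      exact congrArg (teleShape anJ.{u}).base (Subtype.ext (LFVertex.shiftObj_shiftObj m m' a.1))
    | obs => rfl
  · cases a with
    | obs =>
      cases b with
      | obs => exact PEmpty.elim e
      | base b =>
        obtain ⟨x, hx⟩ := b
        cases x <;> first | exact (PEmpty.elim e) | (cases e; exact HEq.rfl)
    | base a =>
      obtain ⟨x, hx⟩ := a
      cases b with
      | obs => cases x <;> first | exact (PEmpty.elim e) | (cases e; exact HEq.rfl)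
      | base b => exact LFVertex.shiftHom_shiftHom_heq m m' e

/-- The shift by `0` is the identity morphism of `Γ⃗_{𝒟_An}`. [cite: MochizukiAbsTopIII2015, Corollary 3.6 (v) p.80] -/
theorem teleShift_zero : teleShift.{u} 0 = 𝟭q (teleShape anJ.{u}).Vertex := by
  refine Prefunctor.ext_of_heq'' (fun w => ?_) (fun a b e => ?_)
  · cases w with
    | base a =>
      show (teleShape anJ.{u}).base _ = (teleShape anJ.{u}).base _
      exact congrArg (teleShape anJ.{u}).base (Subtype.ext (LFVertex.shiftObj_zero a.1))
    | obs => rfl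
  · cases a with
    | obs =>
      cases b with
      | obs => exact PEmpty.elim e
      | base b =>
        obtain ⟨x, hx⟩ := b
        cases x <;> first | exact (PEmpty.elim e) | (cases e; exact HEq.rfl)
    | base a =>
      obtain ⟨x, hx⟩ := a
      cases b with
      | obs => cases x <;> first | exact (PEmpty.elim e) | (cases e; exact HEq.rfl)
      | base b => exact LFVertex.shiftHom_zero_heq e

/-- `teleShift m ⋙ teleShift (-m) = id`. [cite: MochizukiAbsTopIII2015, Corollary 3.6 (v) p.80] -/
theorem teleShift_comp_neg (m : ℤ) :
    teleShift.{u} m ⋙q teleShift.{u} (-m) = 𝟭q (teleShape anJ.{u}).Vertex := by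
  rw [teleShift_comp, Int.add_right_neg, teleShift_zero]

/-- `teleShift (-m) ⋙ teleShift m = id`. [cite: MochizukiAbsTopIII2015, Corollary 3.6 (v) p.80] -/
theorem teleShift_neg_comp (m : ℤ) :
    teleShift.{u} (-m) ⋙q teleShift.{u} m = 𝟭q (teleShape anJ.{u}).Vertex := by
  rw [teleShift_comp, Int.add_left_neg, teleShift_zero]

/-- On vertices: `(w + m) - m = w`. [cite: MochizukiAbsTopIII2015, Corollary 3.6 (v) p.80] -/
theorem teleShiftObj_neg_teleShiftObj (m : ℤ) (w : (teleShape anJ.{u}).Vertex) :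
    teleShiftObj (-m) (teleShiftObj m w) = w :=
  congrArg (fun H : (teleShape anJ.{u}).Vertex ⥤q (teleShape anJ.{u}).Vertex => H.obj w)
    (teleShift_comp_neg m)

/-! ### The shift as a 1-morphism of `𝒟_An` -/

variable (Δ : LogFrobeniusData.{u}) (τ : Δ.TelecoreData)

/-- The shift commutes STRICTLY with the functors of `𝒟`: `Φ_a ⋙ 𝒟_{Φe} = 𝒟_e ⋙ Φ_b` (the shifted edge
carries the same functor and the `Φ_a` are identity functors). [cite: MochizukiAbsTopIII2015, Corollary 3.6 (v) p.80] -/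
theorem shiftApp_comm (m : ℤ) {a b : LFVertex} (e : a ⟶ b) :
    Δ.shiftApp m a ⋙ Δ.diagram.map (LFVertex.shiftHom m e) = Δ.diagram.map e ⋙ Δ.shiftApp m b := by
  cases a <;> cases b <;>
    first
      | exact (PEmpty.elim e)
      | exact (Functor.id_comp _).trans (Functor.comp_id _).symm

/-- The functors of the extended shift: the identity functors (`Δ.shiftApp m` on `𝒟_{≤4}`, `𝟭` at the
core vertex `Anab`). [cite: MochizukiAbsTopIII2015, Corollary 3.6 (v) p.80] -/
def teleShiftApp (m : ℤ) : ∀ w : (teleShape anJ.{u}).Vertex,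
    (Δ.teleDiagram anJ (Δ.anTelMap τ)).obj w ⥤ (Δ.teleDiagram anJ (Δ.anTelMap τ)).obj (teleShiftObj m w)
  | ExtVertex.base a => Δ.shiftApp m a.1
  | ExtVertex.obs => 𝟭 Δ.A

/-- The telecore functors `φ_⋏` commute (strictly) with the identity functors of the shift. [folklore] -/
private theorem anTelMap_shift_comm (m : ℤ) : ∀ (b : SubVertex {a : LFVertex | a.row ≤ 4})
    (h : LFVertex.shiftObj m b.1 ∈ {a : LFVertex | a.row ≤ 4}) (j : anJ.{u} b),
    𝟭 Δ.A ⋙ Δ.anTelMap τ (a := ⟨LFVertex.shiftObj m b.1, h⟩) (anJShift m b h j) =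
      Δ.anTelMap τ j ⋙ Δ.shiftApp m b.1
  | ⟨.row1 _, _⟩, _, _ => (Functor.id_comp _).trans (Functor.comp_id _).symm
  | ⟨.nexus, _⟩, _, _ => (Functor.id_comp _).trans (Functor.comp_id _).symm
  | ⟨.third, _⟩, _, j => PEmpty.elim j
  | ⟨.fourth, _⟩, _, j => PEmpty.elim j
  | ⟨.fifth, _⟩, _, j => PEmpty.elim j
  | ⟨.sixth, _⟩, _, j => PEmpty.elim j

/-- The observation functor `κ_An` commutes (strictly) with the identity functors of the shift. [folklore] -/
private theorem obsMap_shift_comm (m : ℤ) : ∀ (a : SubVertex {a : LFVertex | a.row ≤ 4})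
    (h : LFVertex.shiftObj m a.1 ∈ {a : LFVertex | a.row ≤ 4}) (i : coreI5.{u} a),
    Δ.shiftApp m a.1 ⋙ Δ.coreExt5.obsMap (a := ⟨LFVertex.shiftObj m a.1, h⟩) (coreI5Shift m a h i) =
      Δ.coreExt5.obsMap i ⋙ 𝟭 Δ.A
  | ⟨.fourth, _⟩, _, _ => (Functor.id_comp _).trans (Functor.comp_id _).symm
  | ⟨.row1 _, _⟩, _, i => PEmpty.elim i
  | ⟨.nexus, _⟩, _, i => PEmpty.elim i
  | ⟨.third, _⟩, _, i => PEmpty.elim i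
  | ⟨.fifth, _⟩, _, i => PEmpty.elim i
  | ⟨.sixth, _⟩, _, i => PEmpty.elim i

/-- **The extended shift commutes STRICTLY with the functors of `𝒟_An`.** [cite: MochizukiAbsTopIII2015, Corollary 3.6 (v) p.80] -/
theorem teleShift_comm (m : ℤ) {a b : (teleShape anJ.{u}).Vertex} (e : a ⟶ b) :
    Δ.teleShiftApp τ m a ⋙ (Δ.teleDiagram anJ (Δ.anTelMap τ)).map (teleShiftHom m e) =
      (Δ.teleDiagram anJ (Δ.anTelMap τ)).map e ⋙ Δ.teleShiftApp τ m b := by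
  cases a with
  | base a =>
    cases b with
    | base b => exact Δ.shiftApp_comm m e
    | obs => exact Δ.obsMap_shift_comm m a _ e
  | obs =>
    cases b with
    | base b => exact Δ.anTelMap_shift_comm τ m b _ e
    | obs => exact PEmpty.elim e

/-- The same, with the shifted edge written through `teleShift`. [cite: MochizukiAbsTopIII2015, Corollary 3.6 (v) p.80] -/
theorem teleShift_comm' (m : ℤ) {a b : (teleShape anJ.{u}).Vertex} (e : a ⟶ b) :
    Δ.teleShiftApp τ m a ⋙ (Δ.teleDiagram anJ (Δ.anTelMap τ)).map ((teleShift m).map e) =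
      (Δ.teleDiagram anJ (Δ.anTelMap τ)).map e ⋙ Δ.teleShiftApp τ m b :=
  Δ.teleShift_comm τ m e

/-- **The extended shift `Ψ_m : 𝒟_An → 𝒟_An` as a 1-morphism of diagrams of categories** (Def. 3.5 (v))
over `teleShift m`: identity functors at the vertices, identity 2-cells at the edges ("the technique
of extension applied in Definition 3.5, (vi)"). [cite: MochizukiAbsTopIII2015, Corollary 3.6 (v) p.80] -/
def teleShiftMor (m : ℤ) :
    OneMorphism (teleShift m) (Δ.teleDiagram anJ (Δ.anTelMap τ)) (Δ.teleDiagram anJ (Δ.anTelMap τ)) where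
  app := Δ.teleShiftApp τ m
  iso e := eqToIso (Δ.teleShift_comm τ m e)

/-- The 2-cells of `Ψ_m` are `eqToIso`s (by construction). [cite: MochizukiAbsTopIII2015, Corollary 3.6 (v) p.80] -/
theorem teleShiftMor_iso_eq (m : ℤ) {a b : (teleShape anJ.{u}).Vertex} (e : a ⟶ b) :
    ∃ H, (Δ.teleShiftMor τ m).iso e = eqToIso H :=
  ⟨Δ.teleShift_comm τ m e, rfl⟩

/-- The vertex functors of `Ψ_m` are identity functors (heterogeneously). [cite: MochizukiAbsTopIII2015, Corollary 3.6 (v) p.80] -/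
theorem teleShiftApp_heq_id (m : ℤ) (w : (teleShape anJ.{u}).Vertex) :
    HEq (Δ.teleShiftApp τ m w) (𝟭 ((Δ.teleDiagram anJ (Δ.anTelMap τ)).obj w)) := by
  cases w with
  | base a => exact Δ.shiftApp_heq_id m a.1
  | obs => exact HEq.rfl

/-- The vertex functors of `Ψ_m ∘ Ψ_{m'}` are identity functors (heterogeneously). [cite: MochizukiAbsTopIII2015, Corollary 3.6 (v) p.80] -/
theorem teleShiftApp_comp_heq_id (m m' : ℤ) (w : (teleShape anJ.{u}).Vertex) :
    HEq (Δ.teleShiftApp τ m w ⋙ Δ.teleShiftApp τ m' (teleShiftObj m w))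
      (𝟭 ((Δ.teleDiagram anJ (Δ.anTelMap τ)).obj w)) := by
  cases w with
  | base a =>
    obtain ⟨x, hx⟩ := a
    cases x <;> exact HEq.rfl
  | obs => exact HEq.rfl

/-! ### `Ψ_m` is an equivalence of diagrams of categories -/

section EqToHomCalculus

variable {V : Type w'} [Quiver.{v'} V] {D : DiagramOfCategories.{v', u, w'} V}

/-- The components of the 2-cells of a composite of two 1-morphisms whose 2-cells have `eqToHom`
components are `eqToHom`s (bookkeeping for Def. 3.5 (v) "`Ψ ∘ Φ` isomorphic to the identity").
[cite: MochizukiAbsTopIII2015, Definition 3.5 (v) p.76] -/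
private theorem comp_iso_app_eq_eqToHom {F G : V ⥤q V} (Φ : OneMorphism F D D) (Ψ : OneMorphism G D D)
    (hΦ : ∀ ⦃a b : V⦄ (e : a ⟶ b) (x : D.obj a), ∃ h, (Φ.iso e).hom.app x = eqToHom h)
    (hΨ : ∀ ⦃a b : V⦄ (e : a ⟶ b) (x : D.obj a), ∃ h, (Ψ.iso e).hom.app x = eqToHom h)
    ⦃a b : V⦄ (e : a ⟶ b) (x : D.obj a) : ∃ h, ((Φ.comp Ψ).iso e).hom.app x = eqToHom h := by
  obtain ⟨h1, e1⟩ := hΦ e x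
  obtain ⟨h2, e2⟩ := hΨ (F.map e) ((Φ.app a).obj x)
  refine ⟨?_, ?_⟩
  swap
  · simp only [OneMorphism.comp, Iso.trans_hom, Iso.symm_hom, NatTrans.comp_app,
      Functor.associator_hom_app, Functor.associator_inv_app, Functor.isoWhiskerLeft_hom,
      Functor.isoWhiskerRight_hom, Functor.whiskerLeft_app, Functor.whiskerRight_app, e1, e2,
      eqToHom_map]
    repeat erw [Category.id_comp]
    repeat erw [Category.comp_id]
    exact eqToHom_trans _ _

/-- The identity 1-morphism has identity 2-cells, componentwise. [folklore] -/
private theorem id_iso_app_eq_eqToHom ⦃a b : V⦄ (e : a ⟶ b) (x : D.obj a) :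
    ∃ h, ((OneMorphism.id D).iso e).hom.app x = eqToHom h :=
  ⟨rfl, by
    simp only [OneMorphism.id, Iso.trans_hom, Iso.symm_hom, NatTrans.comp_app,
      Functor.leftUnitor_hom_app, Functor.rightUnitor_inv_app]
    erw [Category.comp_id]
    rfl⟩

end EqToHomCalculus

/-- The 2-cells of `Ψ_m` have identity components. [cite: MochizukiAbsTopIII2015, Corollary 3.6 (v) p.80] -/
theorem teleShiftMor_iso_app (m : ℤ) ⦃a b : (teleShape anJ.{u}).Vertex⦄ (e : a ⟶ b)
    (x : (Δ.teleDiagram anJ (Δ.anTelMap τ)).obj a) :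
    ∃ h, ((Δ.teleShiftMor τ m).iso e).hom.app x = eqToHom h :=
  ⟨Functor.congr_obj (Δ.teleShift_comm τ m e) x, eqToHom_app (Δ.teleShift_comm τ m e) x⟩

/-- **`Ψ_m` is an equivalence of diagrams of categories** (Def. 3.5 (v)), with quasi-inverse `Ψ_{-m}`.
[cite: MochizukiAbsTopIII2015, Corollary 3.6 (v) p.80] -/
theorem teleShiftMor_isEquivalence (m : ℤ) : (Δ.teleShiftMor τ m).IsEquivalence := by
  refine ⟨teleShift (-m), Δ.teleShiftMor τ (-m), teleShift_comp_neg m, teleShift_neg_comp m, ?_, ?_⟩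
  · exact OneMorphism.isomorphic_transport _ _ _ (fun w => Δ.teleShiftApp_comp_heq_id τ m (-m) w)
      (comp_iso_app_eq_eqToHom _ _ (Δ.teleShiftMor_iso_app τ m) (Δ.teleShiftMor_iso_app τ (-m)))
      id_iso_app_eq_eqToHom
  · exact OneMorphism.isomorphic_transport _ _ _ (fun w => Δ.teleShiftApp_comp_heq_id τ (-m) m w)
      (comp_iso_app_eq_eqToHom _ _ (Δ.teleShiftMor_iso_app τ (-m)) (Δ.teleShiftMor_iso_app τ m))
      id_iso_app_eq_eqToHom

/-- **The extended shift `Ψ_m` as a self-equivalence of `𝒟_An`** (Def. 3.5 (v)).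
[cite: MochizukiAbsTopIII2015, Corollary 3.6 (v) p.80] -/
def teleShiftEquiv (m : ℤ) : (Δ.teleDiagram anJ (Δ.anTelMap τ)).SelfEquivalence :=
  ⟨teleShift m, Δ.teleShiftMor τ m, Δ.teleShiftMor_isEquivalence τ m⟩

/-- **`Ψ_m` extends `Φ_m` on `𝒟_{≤4}`**: the same map on the vertices (hence the same categories) and
the same (identity) functors as the shift `shiftEquiv m` of `𝒟` — the first agreement clause of
`ShiftTelecoreCompatStmt`. [cite: MochizukiAbsTopIII2015, Corollary 3.6 (v) p.80] -/
theorem teleShiftEquiv_base (m : ℤ) (a : SubVertex {a : LFVertex | a.row ≤ 4}) :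
    ∃ h : (Δ.shiftEquiv m).graphMap.obj a.1 ∈ {a : LFVertex | a.row ≤ 4},
      (Δ.teleShiftEquiv τ m).graphMap.obj ((teleShape anJ).base a) = (teleShape anJ).base ⟨_, h⟩ ∧
        HEq ((Δ.teleShiftEquiv τ m).hom.app ((teleShape anJ).base a)) ((Δ.shiftEquiv m).hom.app a.1) :=
  ⟨LFVertex.shiftObj_mem_of_mem m a.2, rfl, HEq.rfl⟩

/-- **`Ψ_m` is the identity at the core vertex `Anab`** — the second agreement clause of
`ShiftTelecoreCompatStmt` ("the technique of extension applied in Definition 3.5, (vi)": the identity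
self-equivalence at the appended vertex). [cite: MochizukiAbsTopIII2015, Corollary 3.6 (v) p.80] -/
theorem teleShiftEquiv_obs (m : ℤ) :
    (Δ.teleShiftEquiv τ m).graphMap.obj (teleShape anJ).obs = (teleShape anJ).obs ∧
      HEq ((Δ.teleShiftEquiv τ m).hom.app (teleShape anJ).obs) (𝟭 Δ.A) :=
  ⟨rfl, HEq.rfl⟩

end LogFrobeniusData

end Literature.AnabelianGeometry.AbsoluteAnabelian
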